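import Literature.MathematicalPhysics.QuantumFieldTheory.Balaban1983to89.Node00.CarriersB12Package
import Literature.MathematicalPhysics.QuantumFieldTheory.Balaban1983to89.Node00.Sect2RegionGeometry

/-!
# NODE 00 → N09 conjunct 1 — the FUNDAMENTAL CASE `X ⊂ □̃²` of LEMMA 4 (3.53) [Balaban1987RG1] at the [B12 §§2–5] group of record:
# the seven region inclusions `X ⊂ Y = □̃³`, `X̃⁻² ⊂ X`, `X, Y ⊂ (□̃⁵)^{∼−2}` of the by-reference package PROVED for the objects of record,
# their non-vacuity (the origin instance), and Lemma 4 at the frame of record from the fundamental case + the by-reference inputs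

Seat `pub-ymgap-dag-n09-c` (g2), 2026-08-26; dag-lead FAN-OUT v1.1 §N09 s1 («CONJUNCT 1: Lemma 4 (3.53) AS PRINTED for the NON-TRIVIAL input
package — `lemma4Printed_frameOf` is proved for every package; the missing piece is NODE 00 NAMING the package and the seat discharging … there»).
THEOREMS ONLY; imports NODE 00's companion `Node00/CarriersB12Package` (seat node00-def-B12 g0: `B12Package`, `b12LeafOfRecord_of_package`,
`b12LeafOfRecord₁₁_of_package`, `b12_leaf_of_isRecordOfRecord₁₁CB10YZWB8B12_of_package`; hence node00-def g32's `Node00/CarriersB12` ∕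
`Node00/Record11CarriersB12`: `IdxB12`, `ResidB12Run`, `F12OfRecord`, `B12LeafOfRecord`, `ResidB12`, `B12LeafOfRecord₁₁`, `IsRecordOfRecord₁₁CB10YZWB8B12`)
and this seat's `Node00/Sect2RegionGeometry` (p455158: generic torus geometry of 11b's `Sect2.enlT ∕ innerT ∕ regionOfSet ∕ frameI`); no `def`, no
`instance`, no `notation`, no `sorry`; everything upstream CONSUMED BY NAME.

WHAT IS PROVED.
* §1 `IdxB12`: `□ ⊆ □̃ⁿ`, `□̃ⁿ ⊆ □̃ⁿ′` (`n ≤ n′`), `□̃ᵃ ⊆ (□̃^{a+b})^{∼−b}` for the instance's `π_{k+1}`-cubes; NON-VACUITY of the fundamental case: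
  for every `1 ≤ j ≤ k` the ORIGIN instance (□ = the `π_{k+1}`-cube at the origin, `X` = the `π_j`-cube at the origin) has `X ⊆ □ ⊆ □̃ⁿ`
  (`exists_idx_XSites_subset_boxT`; `exists_residB12Run_fundamental`, §4 `exists_residB12_fundamental`) — the binder «`X ⊂ □̃²`» of §3–§4 is
  met by objects of record, not ex falso.
* §2 `ResidB12Run`: the faces `frameX.X = regionOfSet X`, `frameX.X₂ = regionOfSet X̃⁻²`, `frameBox.X₂ = regionOfSet (□̃⁵)^{∼−2}`,
  `regionY = regionOfSet □̃³` (`rfl`), and THE SEVEN REGION FIELDS `hXb hXd hX₂b hX₂p hXp' hYb' hXp` of `B12Package` (= lit-balaban p07's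
  `Lemma4Data` geometry) AT THE FRAMES OF RECORD: `hX₂p : X̃⁻².plaqs ⊆ X.plaqs` and `hYb' : Y.bonds ⊆ (□̃⁵)^{∼−2}.bonds` UNCONDITIONALLY (every
  instance); `hXb`, `hXd`, `hX₂b`, `hXp'`, `hXp` from the ONE inclusion `X ⊆ □̃³` of site sets, hence from print's fundamental case `X ⊆ □̃²` (p. 275).
* §3 the closers at the residual layer: **`b12LeafOfRecord_of_subset_boxT_three`** ∕ **`b12LeafOfRecord_of_fundamental`** — `B12LeafOfRecord Rz cB lam`
  (LEMMA 4 (3.53) AS PRINTED at the frame and constants of record) from `X ⊆ □̃³` (resp. the printed `X ⊆ □̃²`), `0 < O(1)LMB`, the seven further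
  restrictions on the constants (`Cπ = 2`), the BY-REFERENCE PACKAGE `JInputs` ([15], [14]) for every value of the variables in the printed domain and
  the analyticity of the letters `𝐊`, `𝐀₂` — NODE 00's knit face `b12LeafOfRecord_of_package` (= p07's `lemma4Printed_frameOf`) BY NAME on the
  `B12Package` whose seven region fields §2 supplies; and the JOINT SATISFIABILITY of the closers' `Prop` binders at every record with cube size
  `M ≥ 1` and block size `L ≥ 2` (`exists_residB12Run_restrictions`: fundamental case ∧ `0 ∈ A331` ∧ «all the restrictions»
  `B12Sec2to5.Lemma4Restrictions` ∧ the seven further restrictions, by explicit constants `B₃ = 1`, `O(1) = 1∕M`, `β = 3∕10`, …).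
* §4 the same at a Stage-11 parameter (`b12LeafOfRecord₁₁_of_fundamental`) and at a record of `IsRecordOfRecord₁₁CB10YZWB8B12`
  (`b12_leaf_of_isRecordOfRecord₁₁CB10YZWB8B12_of_fundamental`: `(leavesP w P).b12` with WHAT REMAINS DISPLAYED after the geometry made explicit —
  per presenting `(θ, hP, λ₁₂)` and run: the fundamental case, the seven constant restrictions, `JInputs`, the letters' analyticity).

HONEST FRAMING: the geometry is lattice bookkeeping on a finite torus and the closers are NODE 00's ∕ p07's Lemma-4 face transported — the CONTENT of
Lemma 4 stays in the displayed by-reference inputs (`JInputs`: the [15]-functions `𝐇_j(□₀, Q(…))`, `H_{1,j}`, `ℓ`, the gauge transformations with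
their printed costs, the identities (3.39)+(3.37) ∕ (3.42) ∕ (3.38)×2 and the sizes (3.37), (3.45)×2, (3.50), (J2)×2, (J3)) and in the residual letters'
analyticity; nothing of [Balaban1987RG1] ∕ [15] asserted; N09 NOT discharged; count-neutral; one finite `T⁴` programme at fixed `ε` — NOT continuum ∕
ℝ⁴ ∕ OS ∕ mass gap ∕ Clay.  [Balaban1987RG1] = T. Bałaban, Commun. Math. Phys. **109** (1987) 249–301; [15] = [Balaban1985Variational], CMP **102**
(1985) 277–309.
-/

noncomputable section

namespace Literature.MathematicalPhysics.QuantumFieldTheory.Balaban1983to89.Node00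

open T4Continuum AveragingRT T4FiniteEpsInhabited FlowStep FlowStepRuns DagBinding T4DatumAssembly
open B12RegularSpaces111 (Frame Region StepConsts space space' expI grad CondIV)
open B12Eq18Current (ofBackground current)
open B12Lemma4ConcreteFrame (JInputs Lemma4Data frameOf LettersAnalyticAt lemma4Printed_frameOf)
open B12Lemma4Models (slProj slProj_mem_suModel_gc suModel_heGc suModel_hgc_Gc slProj_conj)
open B12RegularSpaces111SpecialUnitary (suModel)
open B12Eq311CurrentExpansion (C311)
open Step B14DomainGeom B14.Eq213MaximalDomains B15Eq112TorusCover TreeLengthTorus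
open scoped Matrix.Norms.L2Operator

variable {P : Params} {N M : ℕ}

/-! ## §1  The instance's cubes `□ ⊆ □̃ⁿ ⊆ □̃ⁿ′`, the ladder `□̃ᵃ ⊆ (□̃^{a+b})^{∼−b}`, and the origin instance of the fundamental case -/

namespace IdxB12

/-- `□ ⊆ □̃ⁿ`. [cite: Balaban1987RG1, p.257 (□ ⊂ □̃ⁿ), p.275] -/
theorem cubeSites_subset_boxT (i : IdxB12 P M) (n : ℕ) : i.cubeSites ⊆ i.boxT n :=
  Sect2.subset_enlT _ _ _

/-- `□̃ⁿ ⊆ □̃ⁿ′` for `n ≤ n′` (in particular `□̃² ⊆ □̃³ = Y ⊆ □̃⁵ = □₀`). [cite: Balaban1987RG1, p.257 (□̃ⁿ), p.275 («X ⊂ □̃²», «□₀ = □̃⁵»)] -/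
theorem boxT_mono (i : IdxB12 P M) {n n' : ℕ} (h : n ≤ n') : i.boxT n ⊆ i.boxT n' :=
  Sect2.enlT_mono_layers _ h _

/-- **`□̃ᵃ ⊆ (□̃^{a+b})^{∼−b}`** for the instance's `π_{k+1}`-cubes (at `a = 3, b = 2`: `Y = □̃³ ⊆ (□₀)^{∼−2}`, `□₀ = □̃⁵`).
[cite: Balaban1987RG1, p.275 («□₀ = □̃⁵»), (3.40) p.278 («on □̃³»), (1.16) p.262] -/
theorem boxT_subset_innerT_boxT (i : IdxB12 P M) (a b : ℕ) :
    i.boxT a ⊆ Sect2.innerT P (side P.L M (i.k + 1)) b (i.boxT (a + b)) :=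
  Sect2.enlT_subset_innerT_enlT _ a b _

/-- The fundamental case `X ⊆ □̃²` gives `X ⊆ □̃³ = Y`. [cite: Balaban1987RG1, p.275 («the fundamental case X ⊂ □̃²»), (3.37) p.277 («on □̃³»)] -/
theorem XSites_subset_boxT_three_of_two (i : IdxB12 P M) (hX : i.XSites ⊆ i.boxT 2) : i.XSites ⊆ i.boxT 3 :=
  hX.trans (i.boxT_mono (by norm_num))

/-- The side of a `π_j`-cube is at most the side of a `π_{k+1}`-cube for `j ≤ k + 1` (`Lʲ M ≤ L^{k+1} M`). [cite: Balaban1987RG1, p.257 (the cubes π_j), p.279 («j ≤ k»)] -/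
theorem side_le_side_of_le {j n : ℕ} (h : j ≤ n) : side P.L M j ≤ side P.L M n :=
  Nat.mul_le_mul_right _ (Nat.pow_le_pow_right P.L_pos h)

/-- On the cover: the `π_j`-cube at the origin lies in the `π_n`-cube at the origin for `j ≤ n`. [cite: Balaban1987RG1, p.257 (nested cube partitions π_j)] -/
theorem cubeExt_origin_subset {j n : ℕ} (h : j ≤ n) :
    cubeExt (side P.L M j) (fun _ : Fin P.d => (0 : ℤ)) 0 ⊆ cubeExt (side P.L M n) (fun _ : Fin P.d => (0 : ℤ)) 0 := by
  intro z hz μ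
  obtain ⟨h1, h2⟩ := hz μ
  have hs : ((side P.L M j : ℕ) : ℤ) ≤ ((side P.L M n : ℕ) : ℤ) := by exact_mod_cast side_le_side_of_le (P := P) (M := M) h
  refine ⟨by simpa using h1, ?_⟩
  simp only [mul_zero, zero_add, add_zero] at h2 ⊢
  linarith

/-- The index of the origin cube lifts to the origin of the cover window. [cite: Balaban1987RG1, p.257 (bookkeeping)] -/
theorem liftIdx_zero (n : ℕ) : Sect2.liftIdx P (fun _ : Fin P.d => (0 : ZMod (Sect2.domCount P M n))) = fun _ => (0 : ℤ) := by
  funext μ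
  simp [Sect2.liftIdx]

/-- **The origin instance of the fundamental case**: for `□` = the `π_{k+1}`-cube at the origin and `X` = the `π_j`-cube at the origin (`j ≤ k`),
`X ⊆ □` as site sets. [cite: Balaban1987RG1, p.257 (nested cube partitions π_j), p.275 («the fundamental case X ⊂ □̃²»)] -/
theorem XSites_origin_subset_cubeSites {k j : ℕ} (hj : 1 ≤ j) (hjk : j ≤ k) :
    (⟨k, j, hj, hjk, fun _ => 0, Sect2.cubeDom P M j fun _ => 0⟩ : IdxB12 P M).XSites ⊆
      (⟨k, j, hj, hjk, fun _ => 0, Sect2.cubeDom P M j fun _ => 0⟩ : IdxB12 P M).cubeSites := by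
  simp only [XSites, cubeSites, Sect2.domSites_cubeDom, cubeEnl, liftIdx_zero, Nat.zero_mul, Nat.cast_zero]
  exact Set.image_mono (cubeExt_origin_subset (hjk.trans (Nat.le_succ k)))

/-- **NON-VACUITY of the fundamental-case binder**: for every `1 ≤ j ≤ k` there is an instance `(k, j, □, X)` of record with `X ⊆ □̃ⁿ` for every
`n` (the origin instance: `X ⊆ □ ⊆ □̃ⁿ`) — in particular one with `X ⊆ □̃²`. [cite: Balaban1987RG1, p.275 («the fundamental case X ⊂ □̃²»)] -/
theorem exists_idx_XSites_subset_boxT (P : Params) (M : ℕ) {k j : ℕ} (hj : 1 ≤ j) (hjk : j ≤ k) (n : ℕ) :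
    ∃ i : IdxB12 P M, i.k = k ∧ i.j = j ∧ i.XSites ⊆ i.boxT n :=
  ⟨⟨k, j, hj, hjk, fun _ => 0, Sect2.cubeDom P M j fun _ => 0⟩, rfl, rfl,
    (XSites_origin_subset_cubeSites hj hjk).trans (cubeSites_subset_boxT _ n)⟩

end IdxB12

/-! ## §2  The seven region fields of the Lemma-4 package at the frames of record -/

namespace ResidB12Run

variable (Rz : Sect2.Residual P (MatA N)) (lam : ResidB12Run P N M)

/-- The region `X` of the frame `F` of `Uᶜ_j(X, ·)` of record is `regionOfSet X` (`rfl`). [cite: Balaban1987RG1, (1.11)–(1.14) p.262] -/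
theorem frameX_X : (lam.frameX Rz).X = Sect2.regionOfSet P lam.idx.XSites := rfl

/-- The region `X̃⁻²` of the frame `F` of record is `regionOfSet (X^{∼−2})` for the `π_j`-cubes (`rfl`). [cite: Balaban1987RG1, (1.16) p.262] -/
theorem frameX_X₂ : (lam.frameX Rz).X₂ = Sect2.regionOfSet P (Sect2.innerT P (side P.L M lam.idx.j) 2 lam.idx.XSites) := rfl

/-- The region `X̃⁻²` of the frame `F′` of `U′ᶜ_{k+1}(□₀, ·)` of record is `regionOfSet ((□̃⁵)^{∼−2})` for the `π_{k+1}`-cubes (`rfl`).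
[cite: Balaban1987RG1, (1.16) p.262, p.275 («□₀ = □̃⁵»)] -/
theorem frameBox_X₂ : (lam.frameBox Rz).X₂ = Sect2.regionOfSet P (Sect2.innerT P (side P.L M (lam.idx.k + 1)) 2 (lam.idx.boxT 5)) := rfl

/-- `Y = regionOfSet □̃³` (`rfl`). [cite: Balaban1987RG1, (3.37) p.277, (3.40) p.278 («on □̃³»)] -/
theorem regionY_eq : lam.regionY = Sect2.regionOfSet P (lam.idx.boxT 3) := rfl

/-- Package field `hXb` at the record: `X.bonds ⊆ Y.bonds` from `X ⊆ □̃³`. [cite: Balaban1987RG1, p.275 («X ⊂ □̃²»), (3.42) p.278 («on □̃³»)] -/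
theorem frameX_X_bonds_subset_regionY (h : lam.idx.XSites ⊆ lam.idx.boxT 3) : (lam.frameX Rz).X.bonds ⊆ lam.regionY.bonds :=
  Sect2.regionOfSet_bonds_mono h

/-- Package field `hXd` at the record: `X.dpairs ⊆ Y.dpairs` from `X ⊆ □̃³`. [cite: Balaban1987RG1, p.275 («X ⊂ □̃²»), (3.37) p.277 («on □̃³»)] -/
theorem frameX_X_dpairs_subset_regionY (h : lam.idx.XSites ⊆ lam.idx.boxT 3) : (lam.frameX Rz).X.dpairs ⊆ lam.regionY.dpairs :=
  Sect2.regionOfSet_dpairs_mono h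

/-- Package field `hX₂b` at the record: `X̃⁻².bonds ⊆ Y.bonds` from `X ⊆ □̃³`. [cite: Balaban1987RG1, (1.16) p.262, p.275 («X ⊂ □̃²»)] -/
theorem frameX_X₂_bonds_subset_regionY (h : lam.idx.XSites ⊆ lam.idx.boxT 3) : (lam.frameX Rz).X₂.bonds ⊆ lam.regionY.bonds :=
  (Sect2.frameI_X₂_bonds_subset Rz M lam.idx.j lam.idx.XSites).trans (Sect2.regionOfSet_bonds_mono h)

/-- Package field `hX₂p` at the record, UNCONDITIONALLY: `X̃⁻².plaqs ⊆ X.plaqs`. [cite: Balaban1987RG1, (1.16) p.262 («on X̃⁻²»)] -/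
theorem frameX_X₂_plaqs_subset_X : (lam.frameX Rz).X₂.plaqs ⊆ (lam.frameX Rz).X.plaqs :=
  Sect2.frameI_X₂_plaqs_subset Rz M lam.idx.j lam.idx.XSites

/-- Package field `hXp'` at the record: `X.plaqs ⊆ ((□̃⁵)^{∼−2}).plaqs` from `X ⊆ □̃³` (ladder `□̃³ ⊆ (□̃⁵)^{∼−2}`).
[cite: Balaban1987RG1, p.275 («X ⊂ □̃²», «□₀ = □̃⁵»), (1.16) p.262] -/
theorem frameX_X_plaqs_subset_frameBox_X₂ (h : lam.idx.XSites ⊆ lam.idx.boxT 3) : (lam.frameX Rz).X.plaqs ⊆ (lam.frameBox Rz).X₂.plaqs :=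
  (Sect2.regionOfSet_plaqs_mono h).trans (Sect2.regionOfSet_enlT_plaqs_subset_frameI_X₂ Rz M (lam.idx.k + 1) 3 lam.idx.cubeSites)

/-- Package field `hYb'` at the record, UNCONDITIONALLY: `Y.bonds ⊆ ((□̃⁵)^{∼−2}).bonds` (ladder `□̃³ ⊆ (□̃⁵)^{∼−2}`).
[cite: Balaban1987RG1, p.275 («□₀ = □̃⁵»), (3.40) p.278 («on □̃³»), (1.16) p.262] -/
theorem regionY_bonds_subset_frameBox_X₂ : lam.regionY.bonds ⊆ (lam.frameBox Rz).X₂.bonds :=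
  Sect2.regionOfSet_enlT_bonds_subset_frameI_X₂ Rz M (lam.idx.k + 1) 3 lam.idx.cubeSites

/-- Package field `hXp` at the record: the four bonds and the two derivative stencils of every plaquette of `X` lie in `Y`, from `X ⊆ □̃³`.
[cite: Balaban1987RG1, (1.11)–(1.14) p.262, p.275 («X ⊂ □̃²»), (3.37) p.277 («on □̃³»)] -/
theorem stencil_subset_regionY (h : lam.idx.XSites ⊆ lam.idx.boxT 3) :
    ∀ p ∈ (lam.frameX Rz).X.plaqs, (⟨p.src, p.μ⟩ : PBond P 0) ∈ lam.regionY.bonds ∧ (⟨p.src.shift p.μ, p.ν⟩ : PBond P 0) ∈ lam.regionY.bonds ∧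
      (⟨p.src.shift p.ν, p.μ⟩ : PBond P 0) ∈ lam.regionY.bonds ∧ (⟨p.src, p.ν⟩ : PBond P 0) ∈ lam.regionY.bonds ∧
      (p.src, p.μ, p.ν) ∈ lam.regionY.dpairs ∧ (p.src, p.ν, p.μ) ∈ lam.regionY.dpairs :=
  fun _ hp => Sect2.stencil_of_mem_plaqs_of_subset h hp

/-- **The seven region fields of the package at the frames of record, bundled**, from `X ⊆ □̃³`.
[cite: Balaban1987RG1, p.275 («X ⊂ □̃²», «□₀ = □̃⁵»), (1.11)–(1.16) p.262, Lemma 4 p.280] -/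
theorem regionFields_of_subset_boxT_three (h : lam.idx.XSites ⊆ lam.idx.boxT 3) :
    (lam.frameX Rz).X.bonds ⊆ lam.regionY.bonds ∧ (lam.frameX Rz).X.dpairs ⊆ lam.regionY.dpairs ∧
      (lam.frameX Rz).X₂.bonds ⊆ lam.regionY.bonds ∧ (lam.frameX Rz).X₂.plaqs ⊆ (lam.frameX Rz).X.plaqs ∧
      (lam.frameX Rz).X.plaqs ⊆ (lam.frameBox Rz).X₂.plaqs ∧ lam.regionY.bonds ⊆ (lam.frameBox Rz).X₂.bonds ∧
      (∀ p ∈ (lam.frameX Rz).X.plaqs, (⟨p.src, p.μ⟩ : PBond P 0) ∈ lam.regionY.bonds ∧ (⟨p.src.shift p.μ, p.ν⟩ : PBond P 0) ∈ lam.regionY.bonds ∧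
        (⟨p.src.shift p.ν, p.μ⟩ : PBond P 0) ∈ lam.regionY.bonds ∧ (⟨p.src, p.ν⟩ : PBond P 0) ∈ lam.regionY.bonds ∧
        (p.src, p.μ, p.ν) ∈ lam.regionY.dpairs ∧ (p.src, p.ν, p.μ) ∈ lam.regionY.dpairs) :=
  ⟨lam.frameX_X_bonds_subset_regionY Rz h, lam.frameX_X_dpairs_subset_regionY Rz h, lam.frameX_X₂_bonds_subset_regionY Rz h,
    lam.frameX_X₂_plaqs_subset_X Rz, lam.frameX_X_plaqs_subset_frameBox_X₂ Rz h, lam.regionY_bonds_subset_frameBox_X₂ Rz,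
    lam.stencil_subset_regionY Rz h⟩

/-- The seven region fields of the package at the frames of record from print's fundamental case `X ⊆ □̃²`.
[cite: Balaban1987RG1, p.275 («Let us consider at first the fundamental case X ⊂ □̃²»), Lemma 4 p.280] -/
theorem regionFields_of_fundamental (hX : lam.idx.XSites ⊆ lam.idx.boxT 2) :
    (lam.frameX Rz).X.bonds ⊆ lam.regionY.bonds ∧ (lam.frameX Rz).X.dpairs ⊆ lam.regionY.dpairs ∧
      (lam.frameX Rz).X₂.bonds ⊆ lam.regionY.bonds ∧ (lam.frameX Rz).X₂.plaqs ⊆ (lam.frameX Rz).X.plaqs ∧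
      (lam.frameX Rz).X.plaqs ⊆ (lam.frameBox Rz).X₂.plaqs ∧ lam.regionY.bonds ⊆ (lam.frameBox Rz).X₂.bonds ∧
      (∀ p ∈ (lam.frameX Rz).X.plaqs, (⟨p.src, p.μ⟩ : PBond P 0) ∈ lam.regionY.bonds ∧ (⟨p.src.shift p.μ, p.ν⟩ : PBond P 0) ∈ lam.regionY.bonds ∧
        (⟨p.src.shift p.ν, p.μ⟩ : PBond P 0) ∈ lam.regionY.bonds ∧ (⟨p.src, p.ν⟩ : PBond P 0) ∈ lam.regionY.bonds ∧
        (p.src, p.μ, p.ν) ∈ lam.regionY.dpairs ∧ (p.src, p.ν, p.μ) ∈ lam.regionY.dpairs) :=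
  lam.regionFields_of_subset_boxT_three Rz (lam.idx.XSites_subset_boxT_three_of_two hX)

end ResidB12Run

/-- **NON-VACUITY of the fundamental-case binder at the residual layer**: a residual datum of record whose instance is in the fundamental case
`X ⊆ □̃²` (the origin instance at `k = j = 1`, zero letters, the whole class, zero constants — a witness for the BINDER, not objects of print).
[cite: Balaban1987RG1, p.275 («the fundamental case X ⊂ □̃²») (bookkeeping)] -/
theorem exists_residB12Run_fundamental (P : Params) (N M : ℕ) : ∃ lam : ResidB12Run P N M, lam.idx.XSites ⊆ lam.idx.boxT 2 := by
  obtain ⟨i, -, -, hi⟩ := IdxB12.exists_idx_XSites_subset_boxT P M (k := 1) (j := 1) le_rfl le_rfl 2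
  exact ⟨{ idx := i, K := fun _ _ _ _ => 0, A₂ := fun _ _ _ _ _ => 0, A331 := Set.univ,
           B₃ := 0, O₁ := 0, β₀ := 0, β := 0, α₀ := 0, α₁ := 0, α₂ := 0, α₃ := 0, B₃'' := 0 }, hi⟩

/-! ## §3  Lemma 4 (3.53) at the group of record from the fundamental case and the by-reference inputs -/

section Closer

/-- **LEMMA 4 (3.53) AT THE GROUP OF RECORD FROM `X ⊆ □̃³` AND THE BY-REFERENCE INPUTS**: `B12LeafOfRecord Rz cB lam` (the printed statement
`B12Sec2to5.Lemma4Printed` at the frame `F12OfRecord Rz cB lam` and the constants `lam.consts` of record) from: `X ⊆ □̃³` as site sets (the seven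
region fields of the package are then theorems, §2), `0 < O(1)LMB`, the seven further restrictions on the constants (`Cπ = 2`), the by-reference
package `JInputs` ([15], [14]: the upper-space datum (3.40), `𝐇_j(□₀, Q(…))`, `H_{1,j}`, `ℓ`, the gauge transformations with their costs, the
identities (3.39)+(3.37) ∕ (3.42) ∕ (3.38)×2, the sizes (3.37), (3.45)×2, (3.50), (J2)×2, (J3)) for every value of the variables in the printed domain,
and the analyticity of the letters `𝐊`, `𝐀₂` along analytic families — NODE 00's knit face `b12LeafOfRecord_of_package` (= lit-balaban p07's
`lemma4Printed_frameOf`) BY NAME on the package `B12Package` whose seven region fields are supplied by §2.  NOT a discharge of N09: the inputs are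
hypotheses. [cite: Balaban1987RG1, Lemma 4 (3.53) p.280 with (3.26)–(3.52) pp.275–280; Balaban1985Variational, (174)–(177) pp.305–306, Prop. 9 p.309] -/
theorem b12LeafOfRecord_of_subset_boxT_three [NeZero N] (Rz : Sect2.Residual P (MatA N)) {cB : ℝ} (hcB : 0 < cB) (lam : ResidB12Run P N M)
    (h : lam.idx.XSites ⊆ lam.idx.boxT 3)
    (hB : 1 ≤ lam.consts.B₃) (hY : 1 ≤ lam.consts.B₃ ^ 2 * lam.consts.O₁ * lam.consts.M)
    (hα₁ : 16 * (lam.consts.O₁ * lam.consts.M * lam.consts.α₁) ≤ lam.consts.β) (hL10 : 1 + 10 * lam.consts.β ≤ lam.consts.L ^ 2)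
    (hB'' : 0 ≤ lam.B₃'') (hres'' : lam.B₃'' * lam.consts.α₃ ≤ lam.consts.β * lam.consts.L⁻¹ ^ 2 * lam.consts.α₀)
    (hresJ : 4 * ((P.d - 1) * ((2 : ℝ) * C311 1)) * (lam.consts.B₃ ^ 2 * lam.consts.O₁ * lam.consts.M) ^ 2 * lam.consts.α₀ ≤ lam.consts.β)
    (inputs : ∀ (Φ : FieldPair P 0 (MatA N)ˣ (MatA N)) (A : PBond P 0 → MatA N) (τ : ℝ) (B' : PBond P 0 → MatA N),
      Φ ∈ space (suModel N) (lam.frameBox Rz) (lam.csBox cB) ((1 + 2 * lam.consts.β) * lam.consts.α₀) ((1 + 2 * lam.consts.β) * lam.consts.α₁) lam.α₀ →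
        A ∈ lam.A331 → 0 ≤ τ → τ ≤ 1 → ‖B'‖ < lam.consts.α₃ →
          JInputs (suModel N) lam.consts (lam.frameX Rz) (lam.frameBox Rz) (lam.csX cB) (lam.csBox cB) lam.regionY (slProj N) lam.idx.η lam.B₃'' lam.α₀
            lam.idx.j τ ‖B'‖ (lam.K Φ A τ) (lam.A₂ Φ A τ B'))
    (hKan : ∀ {E : Type} [NormedAddCommGroup E] [NormedSpace ℂ E] {Φf : E → FieldPair P 0 (MatA N)ˣ (MatA N)} {Af Bf : E → PBond P 0 → MatA N}
      {e₀ : E} (τ : ℝ), LettersAnalyticAt Φf Af Bf e₀ →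
        Φf e₀ ∈ space (suModel N) (lam.frameBox Rz) (lam.csBox cB) ((1 + 2 * lam.consts.β) * lam.consts.α₀) ((1 + 2 * lam.consts.β) * lam.consts.α₁) lam.α₀ →
          Af e₀ ∈ lam.A331 → 0 ≤ τ → τ ≤ 1 → ‖Bf e₀‖ < lam.consts.α₃ → ∀ b, AnalyticAt ℂ (fun e => lam.K (Φf e) (Af e) τ b) e₀)
    (hA2an : ∀ {E : Type} [NormedAddCommGroup E] [NormedSpace ℂ E] {Φf : E → FieldPair P 0 (MatA N)ˣ (MatA N)} {Af Bf : E → PBond P 0 → MatA N}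
      {e₀ : E} (τ : ℝ), LettersAnalyticAt Φf Af Bf e₀ →
        Φf e₀ ∈ space (suModel N) (lam.frameBox Rz) (lam.csBox cB) ((1 + 2 * lam.consts.β) * lam.consts.α₀) ((1 + 2 * lam.consts.β) * lam.consts.α₁) lam.α₀ →
          Af e₀ ∈ lam.A331 → 0 ≤ τ → τ ≤ 1 → ‖Bf e₀‖ < lam.consts.α₃ → ∀ b, AnalyticAt ℂ (fun e => lam.A₂ (Φf e) (Af e) τ (Bf e) b) e₀) :
    B12LeafOfRecord Rz cB lam :=
  b12LeafOfRecord_of_package Rz hcB lam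
    { hB := hB, hY := hY, hα₁ := hα₁, hL10 := hL10, hB'' := hB'', hres'' := hres'', hresJ := hresJ
      hXb := lam.frameX_X_bonds_subset_regionY Rz h
      hXd := lam.frameX_X_dpairs_subset_regionY Rz h
      hX₂b := lam.frameX_X₂_bonds_subset_regionY Rz h
      hX₂p := lam.frameX_X₂_plaqs_subset_X Rz
      hXp' := lam.frameX_X_plaqs_subset_frameBox_X₂ Rz h
      hYb' := lam.regionY_bonds_subset_frameBox_X₂ Rz
      hXp := lam.stencil_subset_regionY Rz h
      inputs := inputs
      hKan := fun τ hLe hΦ hA hτ0 hτ1 hB' => hKan τ hLe hΦ hA hτ0 hτ1 hB'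
      hA2an := fun τ hLe hΦ hA hτ0 hτ1 hB' => hA2an τ hLe hΦ hA hτ0 hτ1 hB' }

/-- **LEMMA 4 (3.53) AT THE GROUP OF RECORD IN PRINT'S FUNDAMENTAL CASE `X ⊂ □̃²`** with the by-reference inputs displayed: the previous
theorem at `X ⊆ □̃² ⊆ □̃³`.  NOT a discharge of N09: the inputs are hypotheses; the binder `X ⊆ □̃²` is met by objects of record
(`IdxB12.exists_idx_XSites_subset_boxT`, `exists_residB12Run_fundamental`).
[cite: Balaban1987RG1, Lemma 4 (3.53) p.280, p.275 («Let us consider at first the fundamental case X ⊂ □̃²»)] -/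
theorem b12LeafOfRecord_of_fundamental [NeZero N] (Rz : Sect2.Residual P (MatA N)) {cB : ℝ} (hcB : 0 < cB) (lam : ResidB12Run P N M)
    (hX : lam.idx.XSites ⊆ lam.idx.boxT 2)
    (hB : 1 ≤ lam.consts.B₃) (hY : 1 ≤ lam.consts.B₃ ^ 2 * lam.consts.O₁ * lam.consts.M)
    (hα₁ : 16 * (lam.consts.O₁ * lam.consts.M * lam.consts.α₁) ≤ lam.consts.β) (hL10 : 1 + 10 * lam.consts.β ≤ lam.consts.L ^ 2)
    (hB'' : 0 ≤ lam.B₃'') (hres'' : lam.B₃'' * lam.consts.α₃ ≤ lam.consts.β * lam.consts.L⁻¹ ^ 2 * lam.consts.α₀)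
    (hresJ : 4 * ((P.d - 1) * ((2 : ℝ) * C311 1)) * (lam.consts.B₃ ^ 2 * lam.consts.O₁ * lam.consts.M) ^ 2 * lam.consts.α₀ ≤ lam.consts.β)
    (inputs : ∀ (Φ : FieldPair P 0 (MatA N)ˣ (MatA N)) (A : PBond P 0 → MatA N) (τ : ℝ) (B' : PBond P 0 → MatA N),
      Φ ∈ space (suModel N) (lam.frameBox Rz) (lam.csBox cB) ((1 + 2 * lam.consts.β) * lam.consts.α₀) ((1 + 2 * lam.consts.β) * lam.consts.α₁) lam.α₀ →
        A ∈ lam.A331 → 0 ≤ τ → τ ≤ 1 → ‖B'‖ < lam.consts.α₃ →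
          JInputs (suModel N) lam.consts (lam.frameX Rz) (lam.frameBox Rz) (lam.csX cB) (lam.csBox cB) lam.regionY (slProj N) lam.idx.η lam.B₃'' lam.α₀
            lam.idx.j τ ‖B'‖ (lam.K Φ A τ) (lam.A₂ Φ A τ B'))
    (hKan : ∀ {E : Type} [NormedAddCommGroup E] [NormedSpace ℂ E] {Φf : E → FieldPair P 0 (MatA N)ˣ (MatA N)} {Af Bf : E → PBond P 0 → MatA N}
      {e₀ : E} (τ : ℝ), LettersAnalyticAt Φf Af Bf e₀ →
        Φf e₀ ∈ space (suModel N) (lam.frameBox Rz) (lam.csBox cB) ((1 + 2 * lam.consts.β) * lam.consts.α₀) ((1 + 2 * lam.consts.β) * lam.consts.α₁) lam.α₀ →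
          Af e₀ ∈ lam.A331 → 0 ≤ τ → τ ≤ 1 → ‖Bf e₀‖ < lam.consts.α₃ → ∀ b, AnalyticAt ℂ (fun e => lam.K (Φf e) (Af e) τ b) e₀)
    (hA2an : ∀ {E : Type} [NormedAddCommGroup E] [NormedSpace ℂ E] {Φf : E → FieldPair P 0 (MatA N)ˣ (MatA N)} {Af Bf : E → PBond P 0 → MatA N}
      {e₀ : E} (τ : ℝ), LettersAnalyticAt Φf Af Bf e₀ →
        Φf e₀ ∈ space (suModel N) (lam.frameBox Rz) (lam.csBox cB) ((1 + 2 * lam.consts.β) * lam.consts.α₀) ((1 + 2 * lam.consts.β) * lam.consts.α₁) lam.α₀ →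
          Af e₀ ∈ lam.A331 → 0 ≤ τ → τ ≤ 1 → ‖Bf e₀‖ < lam.consts.α₃ → ∀ b, AnalyticAt ℂ (fun e => lam.A₂ (Φf e) (Af e) τ (Bf e) b) e₀) :
    B12LeafOfRecord Rz cB lam :=
  b12LeafOfRecord_of_subset_boxT_three Rz hcB lam (lam.idx.XSites_subset_boxT_three_of_two hX) hB hY hα₁ hL10 hB'' hres'' hresJ inputs
    (fun τ hLe hΦ hA hτ0 hτ1 hB' => hKan τ hLe hΦ hA hτ0 hτ1 hB') (fun τ hLe hΦ hA hτ0 hτ1 hB' => hA2an τ hLe hΦ hA hτ0 hτ1 hB')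

/-- **JOINT SATISFIABILITY of the closers' `Prop` binders at the record's cube and block sizes**: for every cube size `M ≥ 1` and block size
`L ≥ 2` there is a residual datum of record in the fundamental case `X ⊆ □̃²`, with `𝐀 = 0` in its class (3.31) (p. 277 «At first let us take
𝐀 = 0»), whose constants satisfy «all the restrictions» `B12Sec2to5.Lemma4Restrictions` (β₀ = ¾, β = 3∕10, `B₃ = 1`, `O(1) = 1∕M`, `α₁ = 3∕160`,
`α₀ = β∕(2(4D + 64))` with `D = (d−1)·2·C_F(1)`, `α₃ = βL⁻²α₀∕2`, `α₂ = 1`, `B₃″ = 1`) AND the seven further restrictions of the package — so the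
hypotheses `hX`, `hB`–`hresJ` of `b12LeafOfRecord_of_fundamental` together with the restriction antecedent of `Lemma4Printed` are not an empty
conjunction at any record (the letters `𝐊 = 𝐀₂ = 0` of this witness are JUNK — a witness for the BINDERS, not objects of print; the by-reference
`JInputs` and the analyticity binders are data about print's letters and are not touched). [cite: Balaban1987RG1, §3 pp.276–280 («all the restrictions»), Lemma 4 p.280] -/
theorem exists_residB12Run_restrictions (P : Params) (N M : ℕ) (hM : 1 ≤ M) (hL : 2 ≤ P.L) :
    ∃ lam : ResidB12Run P N M, lam.idx.XSites ⊆ lam.idx.boxT 2 ∧ (0 : PBond P 0 → MatA N) ∈ lam.A331 ∧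
      B12Sec2to5.Lemma4Restrictions lam.consts ∧
      1 ≤ lam.consts.B₃ ∧ 1 ≤ lam.consts.B₃ ^ 2 * lam.consts.O₁ * lam.consts.M ∧
      16 * (lam.consts.O₁ * lam.consts.M * lam.consts.α₁) ≤ lam.consts.β ∧ 1 + 10 * lam.consts.β ≤ lam.consts.L ^ 2 ∧
      0 ≤ lam.B₃'' ∧ lam.B₃'' * lam.consts.α₃ ≤ lam.consts.β * lam.consts.L⁻¹ ^ 2 * lam.consts.α₀ ∧
      4 * ((P.d - 1) * ((2 : ℝ) * C311 1)) * (lam.consts.B₃ ^ 2 * lam.consts.O₁ * lam.consts.M) ^ 2 * lam.consts.α₀ ≤ lam.consts.β := by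
  obtain ⟨i, -, -, hi⟩ := IdxB12.exists_idx_XSites_subset_boxT P M (k := 1) (j := 1) le_rfl le_rfl 2
  -- the coefficient `D = (d − 1)·Cπ·C_F(1)` of the J-restriction, `Cπ = 2`
  have hD : 0 ≤ ((P.d : ℝ) - 1) * ((2 : ℝ) * C311 1) :=
    mul_nonneg (by have := P.hd; exact sub_nonneg.mpr (by exact_mod_cast this))
      (mul_nonneg zero_le_two (B12CondIIIJConcrete.C311_nonneg 1))
  set D : ℝ := ((P.d : ℝ) - 1) * ((2 : ℝ) * C311 1) with hDdef
  have hMr : (1 : ℝ) ≤ M := by exact_mod_cast hM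
  have hM0 : (M : ℝ) ≠ 0 := by positivity
  have hLr : (2 : ℝ) ≤ P.L := by exact_mod_cast hL
  have hL1 : (1 : ℝ) ≤ P.L := by linarith
  have hLsq : (4 : ℝ) ≤ (P.L : ℝ) ^ 2 := by nlinarith
  have hLinv : ((P.L : ℝ)⁻¹) ^ 2 ≤ 1 := pow_le_one₀ (inv_nonneg.mpr (by linarith)) (inv_le_one_of_one_le₀ hL1)
  have hLinv0 : 0 ≤ ((P.L : ℝ)⁻¹) ^ 2 := by positivity
  have hT : 0 < 2 * (4 * D + 64) := by positivity
  -- `α₀ = β ∕ (2(4D + 64))`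
  set a0 : ℝ := 3 / 10 / (2 * (4 * D + 64)) with ha0def
  have ha0 : 0 < a0 := by positivity
  have ha0' : a0 ≤ 3 / 1280 := by
    rw [ha0def, div_le_iff₀ hT]; nlinarith
  have h16a0 : 16 * a0 ≤ 3 / 10 := by
    rw [ha0def, ← mul_div_assoc, div_le_iff₀ hT]; nlinarith
  have hDa0 : 4 * D * a0 ≤ 3 / 10 := by
    rw [ha0def, ← mul_div_assoc, div_le_iff₀ hT]; nlinarith
  -- `α₃ = β L⁻² α₀ ∕ 2`
  set a3 : ℝ := 3 / 10 * ((P.L : ℝ)⁻¹) ^ 2 * a0 / 2 with ha3def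
  have ha3 : 0 < a3 := by
    rw [ha3def]; have : 0 < ((P.L : ℝ)⁻¹) ^ 2 := by positivity
    positivity
  have ha3' : a3 ≤ 3 / 10 * a0 / 2 := by
    rw [ha3def]; nlinarith
  have hOM : (1 : ℝ) ^ 2 * (1 / (M : ℝ)) * (M : ℝ) = 1 := by field_simp
  have hOM' : 1 / (M : ℝ) * (M : ℝ) = 1 := by field_simp
  refine ⟨{ idx := i, K := fun _ _ _ _ => 0, A₂ := fun _ _ _ _ _ => 0, A331 := Set.univ,
            B₃ := 1, O₁ := 1 / (M : ℝ), β₀ := 3 / 4, β := 3 / 10, α₀ := a0, α₁ := 3 / 160, α₂ := 1, α₃ := a3, B₃'' := 1 },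
    hi, Set.mem_univ _, ?_, le_rfl, ?_, ?_, ?_, zero_le_one, ?_, ?_⟩
  · -- «all the restrictions»
    unfold B12Sec2to5.Lemma4Restrictions ResidB12Run.consts
    dsimp only
    refine ⟨ha0, by norm_num, by norm_num, ha3, by norm_num, by norm_num, by norm_num, by exact_mod_cast hL, ?_, ?_, ?_, ?_, ?_, ?_⟩
    · rw [hOM]; linarith
    · rw [show (4 * (1 : ℝ) ^ 2 * (1 / (M : ℝ)) * (M : ℝ)) = 4 by field_simp]; linarith
    · rw [hOM']; norm_num
    · linarith
    · rw [ha3def]; ring_nf; exact le_rfl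
    · linarith
  · dsimp only [ResidB12Run.consts]; rw [hOM]
  · dsimp only [ResidB12Run.consts]; rw [hOM']; norm_num
  · dsimp only [ResidB12Run.consts]; linarith
  · dsimp only [ResidB12Run.consts]; nlinarith
  · dsimp only [ResidB12Run.consts]; rw [hOM]; linarith

end Closer

/-! ## §4  At a Stage-11 parameter and at a record of `IsRecordOfRecord₁₁CB10YZWB8B12` -/

section Record

variable (F : T4Family) (N : ℕ) [NeZero N]

omit [NeZero N] in
/-- **NON-VACUITY of the fundamental-case binder over a Stage-11 record**: a residual [B12] layer all of whose runs are in the fundamental case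
`X ⊆ □̃²` (the origin instance at every run — a witness for the BINDER, not objects of print). [cite: Balaban1987RG1, p.275 («the fundamental case X ⊂ □̃²») (bookkeeping)] -/
theorem exists_residB12_fundamental (M : ℕ) : ∃ lam12 : ResidB12 F N M, ∀ p, (lam12 p).idx.XSites ⊆ (lam12 p).idx.boxT 2 :=
  ⟨fun p => Classical.choose (exists_residB12Run_fundamental (F.P p.K) N M),
    fun p => Classical.choose_spec (exists_residB12Run_fundamental (F.P p.K) N M)⟩

/-- **The leaf at a Stage-11 parameter in the fundamental case**: `B12LeafOfRecord₁₁ F N θ lam p` from admissibility (`0 < O(1)LMB`), the run's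
instance in the fundamental case `X ⊆ □̃²`, the seven further restrictions on the run's constants, the by-reference package `JInputs` on the printed
domain and the analyticity of the run's letters — NODE 00's `b12LeafOfRecord₁₁_of_package` with the seven region fields supplied by §2.  NOT a
discharge of N09. [cite: Balaban1987RG1, Lemma 4 (3.53) p.280, p.275 («the fundamental case X ⊂ □̃²»)] -/
theorem b12LeafOfRecord₁₁_of_fundamental (θ : Stage11Params F N) (hθ : θ.Admissible) (lam : ResidB12 F N θ.τ9.M) (p : B12.RunParams)
    (hX : (lam p).idx.XSites ⊆ (lam p).idx.boxT 2)
    (hB : 1 ≤ (lam p).consts.B₃) (hY : 1 ≤ (lam p).consts.B₃ ^ 2 * (lam p).consts.O₁ * (lam p).consts.M)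
    (hα₁ : 16 * ((lam p).consts.O₁ * (lam p).consts.M * (lam p).consts.α₁) ≤ (lam p).consts.β) (hL10 : 1 + 10 * (lam p).consts.β ≤ (lam p).consts.L ^ 2)
    (hB'' : 0 ≤ (lam p).B₃'') (hres'' : (lam p).B₃'' * (lam p).consts.α₃ ≤ (lam p).consts.β * (lam p).consts.L⁻¹ ^ 2 * (lam p).consts.α₀)
    (hresJ : 4 * (((F.P p.K).d - 1) * ((2 : ℝ) * C311 1)) * ((lam p).consts.B₃ ^ 2 * (lam p).consts.O₁ * (lam p).consts.M) ^ 2 * (lam p).consts.α₀ ≤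
      (lam p).consts.β)
    (inputs : ∀ (Φ : FieldPair (F.P p.K) 0 (MatA N)ˣ (MatA N)) (A : PBond (F.P p.K) 0 → MatA N) (τ : ℝ) (B' : PBond (F.P p.K) 0 → MatA N),
      Φ ∈ space (suModel N) ((lam p).frameBox (θ.Rz p.K)) ((lam p).csBox θ.s2.cB) ((1 + 2 * (lam p).consts.β) * (lam p).consts.α₀)
          ((1 + 2 * (lam p).consts.β) * (lam p).consts.α₁) (lam p).α₀ →
        A ∈ (lam p).A331 → 0 ≤ τ → τ ≤ 1 → ‖B'‖ < (lam p).consts.α₃ →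
          JInputs (suModel N) (lam p).consts ((lam p).frameX (θ.Rz p.K)) ((lam p).frameBox (θ.Rz p.K)) ((lam p).csX θ.s2.cB) ((lam p).csBox θ.s2.cB)
            (lam p).regionY (slProj N) (lam p).idx.η (lam p).B₃'' (lam p).α₀ (lam p).idx.j τ ‖B'‖ ((lam p).K Φ A τ) ((lam p).A₂ Φ A τ B'))
    (hKan : ∀ {E : Type} [NormedAddCommGroup E] [NormedSpace ℂ E] {Φf : E → FieldPair (F.P p.K) 0 (MatA N)ˣ (MatA N)}
      {Af Bf : E → PBond (F.P p.K) 0 → MatA N} {e₀ : E} (τ : ℝ), LettersAnalyticAt Φf Af Bf e₀ →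
        Φf e₀ ∈ space (suModel N) ((lam p).frameBox (θ.Rz p.K)) ((lam p).csBox θ.s2.cB) ((1 + 2 * (lam p).consts.β) * (lam p).consts.α₀)
            ((1 + 2 * (lam p).consts.β) * (lam p).consts.α₁) (lam p).α₀ →
          Af e₀ ∈ (lam p).A331 → 0 ≤ τ → τ ≤ 1 → ‖Bf e₀‖ < (lam p).consts.α₃ → ∀ b, AnalyticAt ℂ (fun e => (lam p).K (Φf e) (Af e) τ b) e₀)
    (hA2an : ∀ {E : Type} [NormedAddCommGroup E] [NormedSpace ℂ E] {Φf : E → FieldPair (F.P p.K) 0 (MatA N)ˣ (MatA N)}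
      {Af Bf : E → PBond (F.P p.K) 0 → MatA N} {e₀ : E} (τ : ℝ), LettersAnalyticAt Φf Af Bf e₀ →
        Φf e₀ ∈ space (suModel N) ((lam p).frameBox (θ.Rz p.K)) ((lam p).csBox θ.s2.cB) ((1 + 2 * (lam p).consts.β) * (lam p).consts.α₀)
            ((1 + 2 * (lam p).consts.β) * (lam p).consts.α₁) (lam p).α₀ →
          Af e₀ ∈ (lam p).A331 → 0 ≤ τ → τ ≤ 1 → ‖Bf e₀‖ < (lam p).consts.α₃ → ∀ b, AnalyticAt ℂ (fun e => (lam p).A₂ (Φf e) (Af e) τ (Bf e) b) e₀) :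
    B12LeafOfRecord₁₁ F N θ lam p :=
  b12LeafOfRecord_of_fundamental (θ.Rz p.K) hθ.pos.1 (lam p) hX hB hY hα₁ hL10 hB'' hres'' hresJ inputs
    (fun τ hLe hΦ hA hτ0 hτ1 hB' => hKan τ hLe hΦ hA hτ0 hτ1 hB') (fun τ hLe hΦ hA hτ0 hτ1 hB' => hA2an τ hLe hΦ hA hτ0 hτ1 hB')

variable {F N}
variable {D : FiniteEpsData F (SU N)} {w : WorldP}

/-- **`b12` at every run of a record of `IsRecordOfRecord₁₁CB10YZWB8B12` in the fundamental case**, with what REMAINS displayed after the geometry is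
discharged made explicit: for every presenting parameter package `(θ, hP, λ₁₂)` and every run `p` — (i) the run's instance is in the fundamental case
`X ⊆ □̃²`, (ii) the seven further restrictions on the run's constants, (iii) the by-reference package `JInputs` ([15], [14]) for every value of the variables
in the printed domain, (iv)–(v) the analyticity of the run's letters `𝐊`, `𝐀₂` — NODE 00's `b12_leaf_of_isRecordOfRecord₁₁CB10YZWB8B12_of_package`
with the package's seven region fields supplied by §2.  NOT a discharge of N09 (count-neutral): (iii)–(v) ARE the content of pp. 275–280 for the
residual letters of record. [cite: Balaban1987RG1, Lemma 4 (3.53) p.280, p.275 («the fundamental case X ⊂ □̃²»); Balaban1985Variational, (174)–(177) pp.305–306] -/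
theorem b12_leaf_of_isRecordOfRecord₁₁CB10YZWB8B12_of_fundamental (h : IsRecordOfRecord₁₁CB10YZWB8B12 F N D w)
    (hX : ∀ (θ : Stage11Params F N) (hP : θ.Provisos₁₁) (lam12 : ResidB12 F N θ.τ9.M), θ.Admissible → D = datumOfRecord₁₁ F N θ hP →
      ∀ p : B12.RunParams, (lam12 p).idx.XSites ⊆ (lam12 p).idx.boxT 2)
    (hR : ∀ (θ : Stage11Params F N) (hP : θ.Provisos₁₁) (lam12 : ResidB12 F N θ.τ9.M), θ.Admissible → D = datumOfRecord₁₁ F N θ hP →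
      ∀ p : B12.RunParams, 1 ≤ (lam12 p).consts.B₃ ∧ 1 ≤ (lam12 p).consts.B₃ ^ 2 * (lam12 p).consts.O₁ * (lam12 p).consts.M ∧
        16 * ((lam12 p).consts.O₁ * (lam12 p).consts.M * (lam12 p).consts.α₁) ≤ (lam12 p).consts.β ∧
        1 + 10 * (lam12 p).consts.β ≤ (lam12 p).consts.L ^ 2 ∧ 0 ≤ (lam12 p).B₃'' ∧
        (lam12 p).B₃'' * (lam12 p).consts.α₃ ≤ (lam12 p).consts.β * (lam12 p).consts.L⁻¹ ^ 2 * (lam12 p).consts.α₀ ∧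
        4 * (((F.P p.K).d - 1) * ((2 : ℝ) * C311 1)) * ((lam12 p).consts.B₃ ^ 2 * (lam12 p).consts.O₁ * (lam12 p).consts.M) ^ 2 * (lam12 p).consts.α₀ ≤
          (lam12 p).consts.β)
    (inputs : ∀ (θ : Stage11Params F N) (hP : θ.Provisos₁₁) (lam12 : ResidB12 F N θ.τ9.M), θ.Admissible → D = datumOfRecord₁₁ F N θ hP →
      ∀ (p : B12.RunParams) (Φ : FieldPair (F.P p.K) 0 (MatA N)ˣ (MatA N)) (A : PBond (F.P p.K) 0 → MatA N) (τ : ℝ) (B' : PBond (F.P p.K) 0 → MatA N),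
        Φ ∈ space (suModel N) ((lam12 p).frameBox (θ.Rz p.K)) ((lam12 p).csBox θ.s2.cB) ((1 + 2 * (lam12 p).consts.β) * (lam12 p).consts.α₀)
            ((1 + 2 * (lam12 p).consts.β) * (lam12 p).consts.α₁) (lam12 p).α₀ →
          A ∈ (lam12 p).A331 → 0 ≤ τ → τ ≤ 1 → ‖B'‖ < (lam12 p).consts.α₃ →
            JInputs (suModel N) (lam12 p).consts ((lam12 p).frameX (θ.Rz p.K)) ((lam12 p).frameBox (θ.Rz p.K)) ((lam12 p).csX θ.s2.cB)
              ((lam12 p).csBox θ.s2.cB) (lam12 p).regionY (slProj N) (lam12 p).idx.η (lam12 p).B₃'' (lam12 p).α₀ (lam12 p).idx.j τ ‖B'‖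
              ((lam12 p).K Φ A τ) ((lam12 p).A₂ Φ A τ B'))
    (hKan : ∀ (θ : Stage11Params F N) (hP : θ.Provisos₁₁) (lam12 : ResidB12 F N θ.τ9.M), θ.Admissible → D = datumOfRecord₁₁ F N θ hP →
      ∀ (p : B12.RunParams) {E : Type} [NormedAddCommGroup E] [NormedSpace ℂ E] {Φf : E → FieldPair (F.P p.K) 0 (MatA N)ˣ (MatA N)}
        {Af Bf : E → PBond (F.P p.K) 0 → MatA N} {e₀ : E} (τ : ℝ), LettersAnalyticAt Φf Af Bf e₀ →
          Φf e₀ ∈ space (suModel N) ((lam12 p).frameBox (θ.Rz p.K)) ((lam12 p).csBox θ.s2.cB) ((1 + 2 * (lam12 p).consts.β) * (lam12 p).consts.α₀)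
              ((1 + 2 * (lam12 p).consts.β) * (lam12 p).consts.α₁) (lam12 p).α₀ →
            Af e₀ ∈ (lam12 p).A331 → 0 ≤ τ → τ ≤ 1 → ‖Bf e₀‖ < (lam12 p).consts.α₃ →
              ∀ b, AnalyticAt ℂ (fun e => (lam12 p).K (Φf e) (Af e) τ b) e₀)
    (hA2an : ∀ (θ : Stage11Params F N) (hP : θ.Provisos₁₁) (lam12 : ResidB12 F N θ.τ9.M), θ.Admissible → D = datumOfRecord₁₁ F N θ hP →
      ∀ (p : B12.RunParams) {E : Type} [NormedAddCommGroup E] [NormedSpace ℂ E] {Φf : E → FieldPair (F.P p.K) 0 (MatA N)ˣ (MatA N)}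
        {Af Bf : E → PBond (F.P p.K) 0 → MatA N} {e₀ : E} (τ : ℝ), LettersAnalyticAt Φf Af Bf e₀ →
          Φf e₀ ∈ space (suModel N) ((lam12 p).frameBox (θ.Rz p.K)) ((lam12 p).csBox θ.s2.cB) ((1 + 2 * (lam12 p).consts.β) * (lam12 p).consts.α₀)
              ((1 + 2 * (lam12 p).consts.β) * (lam12 p).consts.α₁) (lam12 p).α₀ →
            Af e₀ ∈ (lam12 p).A331 → 0 ≤ τ → τ ≤ 1 → ‖Bf e₀‖ < (lam12 p).consts.α₃ →
              ∀ b, AnalyticAt ℂ (fun e => (lam12 p).A₂ (Φf e) (Af e) τ (Bf e) b) e₀)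
    (P : B12.RunParams) : (leavesP w P).b12 :=
  b12_leaf_of_isRecordOfRecord₁₁CB10YZWB8B12_of_package h
    (fun θ hP lam12 hθ hD p =>
      have h3 : (lam12 p).idx.XSites ⊆ (lam12 p).idx.boxT 3 := (lam12 p).idx.XSites_subset_boxT_three_of_two (hX θ hP lam12 hθ hD p)
      have hR' := hR θ hP lam12 hθ hD p
      { hB := hR'.1, hY := hR'.2.1, hα₁ := hR'.2.2.1, hL10 := hR'.2.2.2.1, hB'' := hR'.2.2.2.2.1, hres'' := hR'.2.2.2.2.2.1
        hresJ := hR'.2.2.2.2.2.2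
        hXb := (lam12 p).frameX_X_bonds_subset_regionY (θ.Rz p.K) h3
        hXd := (lam12 p).frameX_X_dpairs_subset_regionY (θ.Rz p.K) h3
        hX₂b := (lam12 p).frameX_X₂_bonds_subset_regionY (θ.Rz p.K) h3
        hX₂p := (lam12 p).frameX_X₂_plaqs_subset_X (θ.Rz p.K)
        hXp' := (lam12 p).frameX_X_plaqs_subset_frameBox_X₂ (θ.Rz p.K) h3
        hYb' := (lam12 p).regionY_bonds_subset_frameBox_X₂ (θ.Rz p.K)
        hXp := (lam12 p).stencil_subset_regionY (θ.Rz p.K) h3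
        inputs := inputs θ hP lam12 hθ hD p
        hKan := fun τ hLe hΦ hA hτ0 hτ1 hB' => hKan θ hP lam12 hθ hD p τ hLe hΦ hA hτ0 hτ1 hB'
        hA2an := fun τ hLe hΦ hA hτ0 hτ1 hB' => hA2an θ hP lam12 hθ hD p τ hLe hΦ hA hτ0 hτ1 hB' })
    P

end Record

end Literature.MathematicalPhysics.QuantumFieldTheory.Balaban1983to89.Node00

end
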